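import Summits.ABC.IUTFork.Cor312LicenceTameExactGenuineK
import Literature.IUT.LogVolume.DifferentEstimatesCorollaries
import HarnessLib

/-!
# R-H candidate H⋆_𝔡 «DIFFERENT-PRICED PACKET CELL» (D-0079 RESCUE sub-cell R-H, lens TRANSFER, seat abc-iut-lens-transfer-3 gen 0)

[R-H candidate, hypothesis — not a fact.] Candidate file of the abc-iut cell (rung LADDER-ABC:A2.RESCUE.H; plan/rescue/R-H/START-HERE.md v1.1 §4;
R-H ROUND 1 row 16 «diffpriced», plan/rescue/R-H/RH-CANDIDATES.tsv v1.4): author abc-iut-lens-transfer-3 (staging/RH/abc-iut-lens-transfer-3/HStar-diffpriced.lean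
sha16 407902a5ea243470, CARD-diffpriced.md 83e925f7a1004a14); RE-HOMED VERBATIM (declarations byte-identical) through the gate by the row's k2 desk hand
abc-iut-rp-s2 gen 4 per START-HERE §4 «FILING = a prover hand»; the generic (PilotData-level) twin of the tame theorem is `Repair.RHBandTopTame` (p457138). TAKES NO SIDE on [IUTchIII] Cor. 3.12 or on any author; the predicate below is a CANDIDATE
HYPOTHESIS toward the typed S_H (`Cor312Vol.PilotKummerCompatHull` at the window bed `settingPrVolSharp (pilotDataOfK D K) …`), never
asserted, never a Literature fact; typed ≠ proved; instantiated ≠ endorsed.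

THE CANDIDATE (transfer lens; sibling = Arakelov / Faltings height, dictionary row «relative dualising sheaf ↔ different»). At every bad
place `w | p` of the GENUINE `K`-level datum `X := pilotDataOfK D K` ([IUTchI] Def. 3.1) and every label `j = i+1 ∈ 𝔽_l^⋇`:

  `(j² − 1) · P_w ≤ j · δ_w`,   `P_w = X.qPilot w` = the q-pilot degree in `ord_w` units (`2l·P_w = e(w|v)·ord_v(q_v)`, [IUTchI] Ex. 3.2 (iv)),
  `δ_w := e_w · d_w`, `e_w = absRamificationIdx p K_w`, `d_w = differentOrd p K_w` ([IUTchIV] Prop. 1.1 p. 9: the order of a generator of the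
  different of `𝒪_{K_w}` over `ℤ_p`), i.e. `δ_w` = the different exponent of `K_w/ℚ_p` in `ϖ_w`-units.

Reading: of the `j+1` capsule slots of the tensor packet at label `j`, `j` are charged, each at the DIFFERENT price `δ_w` (the tree's own
necessary threshold `Cor312LicenceExactRadius` §3 has `n₁ = ⌊m_Θ/e − (d_I − d_{x₀}) − a_I⌋` with `d_I − d_{x₀} = j·d_{x₀}` at the diagonal
summand — the same `j` differents). TAME stratum (`p ∤ e_w`): `δ_w = e_w − 1` (`differentOrd_eq_of_not_dvd`), so the cell is
`(j²−1)·P_w ≤ j·(e_w − 1)` = the TOP `θ_j = j` of START-HERE §3 (L1)'s band, sandwiched STRICTLY between the I06⋆ cell `(j²−1)·P_w ≤ e_w − 1`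
and the exact licence cell `(j²−1)·P_w ≤ j·(e_w−1) + ((j²P_w − 1) mod e_w)` (DECLARED, k4 amended). WILD stratum (`p ∣ e_w`): `δ_w ≥ e_w`
(`one_le_differentOrd_of_dvd`) replaces `e_w − 1` — «the wild different pays for the wild shell» is the candidate's content there.
[cite: Mochizuki2012, IUTchI Def. 3.1 (b),(c) pp. 61–62, Ex. 3.2 (iv) p. 71; IUTchIV Prop. 1.1 p. 9, Prop. 1.2 (i)(ii) p. 10, Prop. 1.3 p. 11]
[cite: SerreLocalFields1979, Ch. III §6 Prop. 13] [cite: DupuyHilado2025, §3.3, §3.4, §4.9] [claim: Mochizuki2012, status: disputed]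
-/

noncomputable section

open Set Function NumberField IsDedekindDomain
open scoped Pointwise

namespace Summit.ABC.IUTFork.Repair.RH.DiffPriced

open Literature.AnabelianGeometry.AbsoluteAnabelian Literature.IUT.LogThetaLattice Literature.IUT.LogVolume Literature.IUT.HodgeTheaters
open Literature.NumberTheory.NumberFields Literature.NumberTheory.GaloisRepresentations.Ultrametric
open Summit.ABC.IUTFork.Thm311 Summit.ABC.IUTFork.Thm311.Real Summit.ABC.IUTFork.Cor312 Summit.ABC.IUTFork.Cor312.Setting
  Summit.ABC.IUTFork.Cor312Vol Summit.ABC.IUTFork.Cor312Prov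

variable {F K Fbar : Type} [Field F] [NumberField F] [Field K] [NumberField K] [Algebra F K] [Field Fbar]
  [Algebra F Fbar] [Algebra K Fbar] {E : WeierstrassCurve F} [E.IsElliptic] {l : ℕ} {Pb : BadPlacePredicates K}

/-- **The different-priced cell** in one real currency: label `j`, q-degree `P` (`ord_w` units), ramification index `e`, different order `d`
(`ord_p` units, so `e·d` = different exponent in `ord_w` units): `(j² − 1)·P ≤ j·(e·d)`. [R-H candidate, hypothesis — not a fact]
[claim: Mochizuki2012, status: disputed] -/
@[claim "Mochizuki2012" "disputed"]
def Cell (j : ℕ) (P : ℝ) (e : ℕ) (d : ℝ) : Prop := ((j : ℝ) ^ 2 - 1) * P ≤ (j : ℝ) * ((e : ℝ) * d)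

/-- **H⋆_𝔡 — the DIFFERENT-PRICED PACKET CELL at every bad place and every label of the genuine `K`-level datum `pilotDataOfK D K`.**
[R-H candidate, hypothesis — not a fact] (seat abc-iut-lens-transfer-3; CARD `staging/RH/abc-iut-lens-transfer-3/CARD-diffpriced.md`).
[cite: Mochizuki2012, IUTchI Ex. 3.2 (iv) p. 71; IUTchIV Prop. 1.1 p. 9] [claim: Mochizuki2012, status: disputed] -/
@[claim "Mochizuki2012" "disputed"]
def HStarDiffPriced (D : InitialThetaData F K Fbar E l Pb) : Prop :=
  ∀ (pp : Nat.Primes) (i : Fin (pilotDataOfK D K).lstar) (w : (thetaIndex (pilotDataOfK D K)).Fibre (.inr pp)),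
    haveI : Fact (pp : ℕ).Prime := ⟨pp.2⟩
    placeOf (pilotDataOfK D K) pp.1 w ∈ (pilotDataOfK D K).S →
      Cell ((i : ℕ) + 1) ((pilotDataOfK D K).qPilot (placeOf (pilotDataOfK D K) pp.1 w))
        (absRamificationIdx (pp : ℕ) (kOf (pilotDataOfK D K) pp.1 w)) (differentOrd (pp : ℕ) (kOf (pilotDataOfK D K) pp.1 w))

/-- **Integer bookkeeping behind the tame k2 leg**: `(j²−1)·P ≤ j·(e−1)` implies the exact tame licence predicate
`e·((j²P − 1) div e) + 1 − j·(e−1) ≤ P` (drop the remainder `(j²P−1) mod e ≥ 0`). [folklore] -/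
theorem licencePred_of_cell_int {e P : ℤ} (j : ℕ) (he : e ≠ 0)
    (h : (((j : ℕ) : ℤ) ^ 2 - 1) * P ≤ ((j : ℕ) : ℤ) * (e - 1)) :
    e * ((((j : ℕ) : ℤ) ^ 2 * P - 1) / e) + 1 - ((j : ℕ) : ℤ) * (e - 1) ≤ P := by
  have h1 := Int.mul_ediv_add_emod (((j : ℕ) : ℤ) ^ 2 * P - 1) e
  have h2 := Int.emod_nonneg (((j : ℕ) : ℤ) ^ 2 * P - 1) he
  nlinarith [h1, h2, h]

/-! ## k2 door on the TAME stratum (genuine `K`-level datum, REALISING ideles): H⋆_𝔡 ⟹ the (xi-f) licence — sorry-free bookkeeping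
over abc-iut-w5-d009's exact all-tame decision `Cor312Prov.licence_settingPrVolSharp_pilotDataOfK_iff_of_tame` (a k2 HAND re-files it;
the WILD stratum is the candidate's open content and is NOT claimed here). -/

variable (D : InitialThetaData F K Fbar E l Pb) {logv : PadicLogs K} (hlog : LogvAnalytic logv)
  (M : Type) [Field M] [NumberField M]
  (archPk : ∀ (j : (thetaIndex (pilotDataOfK D K)).Label) (vQ : (thetaIndex (pilotDataOfK D K)).VQ),
    Set ((logShellsDH (pilotDataOfK D K) logv).Packet j vQ))
  (archSub : ∀ (j : (thetaIndex (pilotDataOfK D K)).Label) (v : (thetaIndex (pilotDataOfK D K)).V),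
    Set ((logShellsDH (pilotDataOfK D K) logv).Packet j ((thetaIndex (pilotDataOfK D K)).over v)))
  (Ψ : ℤ → ∀ v : (thetaIndex (pilotDataOfK D K)).V, v ∈ (thetaIndex (pilotDataOfK D K)).Vbad →
    Set ((logShellsDH (pilotDataOfK D K) logv).StarPacket v))
  (act : ℤ → ∀ v : (thetaIndex (pilotDataOfK D K)).V, v ∈ (thetaIndex (pilotDataOfK D K)).Vbad →
    (logShellsDH (pilotDataOfK D K) logv).StarPacket v → Module.End ℚ ((logShellsDH (pilotDataOfK D K) logv).StarPacket v))
  (Mmod : ℤ → ∀ j : (thetaIndex (pilotDataOfK D K)).LabelStar, Set ((logShellsDH (pilotDataOfK D K) logv).GlobalPacket j.1))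
  (region : ℤ → ∀ j : (thetaIndex (pilotDataOfK D K)).LabelStar, FinDivisor M → ∀ vQ : (thetaIndex (pilotDataOfK D K)).VQ,
    Set ((logShellsDH (pilotDataOfK D K) logv).Packet j.1 vQ))
  (n : ℤ) {HT : Type} {LogLink : HT → HT → Type} {IsFull : ∀ {s t : HT}, LogLink s t → Prop}
  (lat : LGPGaussianLogThetaLattice LogLink IsFull)
  {Frd : Type} {IsoF : Frd → Frd → Type} {Ob : Frd → Type} {realify : Frd → Frd} {Strip : Type}
  {IsoS : Strip → Strip → Type} {Mv : ∀ v : (thetaIndex (pilotDataOfK D K)).V, v ∈ (thetaIndex (pilotDataOfK D K)).Vbad → Type}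
  [∀ v h, Monoid (Mv v h)]
  (sig : GlobalLGPFrobenioidSignature (thetaIndex (pilotDataOfK D K)).lstar (thetaIndex (pilotDataOfK D K)).V
    (· ∈ (thetaIndex (pilotDataOfK D K)).Vbad) Frd IsoF Ob realify Strip IsoS Mv)
  (split : SplittingMonoids Mv) {ObΔ : Type} {N : ∀ v : (thetaIndex (pilotDataOfK D K)).V, v ∈ (thetaIndex (pilotDataOfK D K)).Vbad → Type}
  [∀ v h, Monoid (N v h)] (qData : QPilotData ObΔ N)
  (tq : ∀ (pp : Nat.Primes) (x : (thetaIndex (pilotDataOfK D K)).Fibre (.inr pp)),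
    haveI : Fact (pp : ℕ).Prime := ⟨pp.2⟩; kOf (pilotDataOfK D K) pp.1 x)
  (t : ∀ (pp : Nat.Primes) (_ : Fin (pilotDataOfK D K).lstar) (x : (thetaIndex (pilotDataOfK D K)).Fibre (.inr pp)),
    haveI : Fact (pp : ℕ).Prime := ⟨pp.2⟩; kOf (pilotDataOfK D K) pp.1 x)
  (htq0 : ∀ pp x, tq pp x ≠ 0)
  (htq1 : ∀ (pp : Nat.Primes) (x : (thetaIndex (pilotDataOfK D K)).Fibre (.inr pp)),
    haveI : Fact (pp : ℕ).Prime := ⟨pp.2⟩; placeOf (pilotDataOfK D K) pp.1 x ∉ (pilotDataOfK D K).S → ‖tq pp x‖ = 1)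
  (ht0 : ∀ pp i x, t pp i x ≠ 0)
  (ht : ∀ (pp : Nat.Primes) (i : Fin (pilotDataOfK D K).lstar) (x : (thetaIndex (pilotDataOfK D K)).Fibre (.inr pp)),
    haveI : Fact (pp : ℕ).Prime := ⟨pp.2⟩
    Real.log ‖t pp i x‖ = -((pilotDataOfK D K).thetaPilot i (placeOf (pilotDataOfK D K) pp.1 x)) *
      logNorm K (placeOf (pilotDataOfK D K) pp.1 x) / localDegree K (placeOf (pilotDataOfK D K) pp.1 x))
  (htq : ∀ (pp : Nat.Primes) (x : (thetaIndex (pilotDataOfK D K)).Fibre (.inr pp)),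
    haveI : Fact (pp : ℕ).Prime := ⟨pp.2⟩
    Real.log ‖tq pp x‖ = -((pilotDataOfK D K).qPilot (placeOf (pilotDataOfK D K) pp.1 x)) *
      logNorm K (placeOf (pilotDataOfK D K) pp.1 x) / localDegree K (placeOf (pilotDataOfK D K) pp.1 x))

include ht0 ht htq in
/-- **k2 (TAME stratum, genuine datum): H⋆_𝔡 ⟹ the (xi-f) licence at `settingPrVolSharp (pilotDataOfK D K) …`.** At a genuine datum whose
bad fibres are uniformly tame (`p > 2`, `e(x|p) = e_p ≤ p − 2`), REALISING Θ- and q-ideles: the tame different is `d_w = (e_p − 1)/e_p`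
(`differentOrd_eq_of_not_dvd`, [SerreLocalFields1979] III §6 Prop. 13), so the cell reads `(j²−1)·P_w ≤ j·(e_p − 1)`, which drops the
remainder of abc-iut-w5-d009's exact predicate `e_p·((j²P_w − 1) div e_p) + 1 − j(e_p − 1) ≤ P_w` (`licencePred_of_cell_int`). Sorry-free
bookkeeping; the seat files nothing (a k2 hand re-files). [cite: Mochizuki2012, IUTchI Ex. 3.2 (iv) p. 71; IUTchIV Prop. 1.1 p. 9, Prop. 1.2 (i)(ii) p. 10]
[cite: DupuyHilado2025, §3.3, §3.4, §4.9] [claim: Mochizuki2012, status: disputed] -/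
theorem licence_settingPrVolSharp_pilotDataOfK_of_hStar_tame (e : Nat.Primes → ℕ)
    (htame : ∀ (pp : Nat.Primes) (x : (thetaIndex (pilotDataOfK D K)).Fibre (.inr pp)),
      haveI : Fact (pp : ℕ).Prime := ⟨pp.2⟩
      (∃ w : (thetaIndex (pilotDataOfK D K)).Fibre (.inr pp), placeOf (pilotDataOfK D K) pp.1 w ∈ (pilotDataOfK D K).S) →
        2 < (pp : ℕ) ∧ e pp ≤ (pp : ℕ) - 2 ∧ (placeOf (pilotDataOfK D K) pp.1 x).asIdeal.ramificationIdx ℤ = e pp)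
    (hH : HStarDiffPriced D) :
    Thm311ToCor312.Licence
      (settingPrVolSharp (pilotDataOfK D K) hlog M archPk archSub Ψ act Mmod region n lat sig split qData tq t htq0 htq1) := by
  rw [licence_settingPrVolSharp_pilotDataOfK_iff_of_tame D hlog M archPk archSub Ψ act Mmod region n lat sig split qData tq t htq0 htq1
    ht0 ht htq e htame]
  intro pp i w hw P hP
  haveI : Fact (pp : ℕ).Prime := ⟨pp.2⟩
  obtain ⟨hp2, hep, hram⟩ := htame pp w ⟨w, hw⟩
  have heK : absRamificationIdx (pp : ℕ) (kOf (pilotDataOfK D K) pp.1 w) = e pp :=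
    (absRamificationIdx_rescaledCompletion K (pp : ℕ) (placeOf (pilotDataOfK D K) pp.1 w)
      (natCast_mem_placeOf (pilotDataOfK D K) pp.1 w)).trans hram
  have he0 : e pp ≠ 0 := by
    have := absRamificationIdx_pos (pp : ℕ) (kOf (pilotDataOfK D K) pp.1 w)
    omega
  have hnd : ¬ (pp : ℕ) ∣ absRamificationIdx (pp : ℕ) (kOf (pilotDataOfK D K) pp.1 w) := by
    rw [heK]
    intro hdvd
    have := Nat.le_of_dvd (Nat.pos_of_ne_zero he0) hdvd
    omega
  have hd := differentOrd_eq_of_not_dvd (pp : ℕ) (kOf (pilotDataOfK D K) pp.1 w) hnd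
  have hcell := hH pp i w hw
  simp only [Cell, hP, hd, heK] at hcell
  have he0' : ((e pp : ℕ) : ℝ) ≠ 0 := by exact_mod_cast he0
  have hmul : ((e pp : ℕ) : ℝ) * ((((e pp : ℕ) : ℝ) - 1) / ((e pp : ℕ) : ℝ)) = ((e pp : ℕ) : ℝ) - 1 := by
    field_simp
  rw [hmul] at hcell
  have hint : ((((i : ℕ) + 1 : ℕ) : ℤ) ^ 2 - 1) * (P : ℤ) ≤ (((i : ℕ) + 1 : ℕ) : ℤ) * ((e pp : ℤ) - 1) := by
    have h' : ((((((i : ℕ) + 1 : ℕ) : ℤ) ^ 2 - 1) * (P : ℤ) : ℤ) : ℝ) ≤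
        (((((i : ℕ) + 1 : ℕ) : ℤ) * ((e pp : ℤ) - 1) : ℤ) : ℝ) := by
      push_cast at hcell ⊢
      linarith
    exact_mod_cast h'
  exact licencePred_of_cell_int ((i : ℕ) + 1) (by exact_mod_cast he0) hint

end Summit.ABC.IUTFork.Repair.RH.DiffPriced

end
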